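import Summits.QuantumFields.YangMills.Theses.CutoffNotchTransport
import Summits.QuantumFields.YangMills.Theorems.CutoffNotchTransportHistoryTailOfNotchRated
import HarnessLib

/-!
# Route `CutoffNotchTransport` — THE GLUE `HistoryTailOfNotch` (support item stmt-QuantumFields-26204), PROVED:
# `NotchMomentRatioL → BareCappedMomentL → (∀ L b₁ p₁, ∃ b₀ p₀ …, ∀ m > 0, ∃ γ₁, ∀ F γ, HistoryTailAt F γ b₀ p₀ m)`

Seat `ym-line-sfw-p1` g11 (home cell `ym-idea-1`), `--workitem stmt-QuantumFields-26204`.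

THE ARGUMENT (the item's informal text, formalised).
* §1 ★ `notch_iterate` — THE INDUCTION OVER ULTRAVIOLET NOTCHES: with the one-notch ratio (the crux, a HYPOTHESIS here) and the bare capped
  moment (the base, landed as `…BareCappedMomentL`), for every run `K`, level `j ≤ K`, plaquette `p` of `T^{(j)}` and tilt `t ≥ 0` with
  `t·Π_{i<j}(1+ε_i) ≤ min t₀ t₁`: `∫ exp(t·β_h·min(|Ū^j(∂p) − 1|², θ(h)²)) dGibbs_K ≤ A^j·C·β_h^N`, `h = K − j` — the chain
  `(K,j) → (K−1,j−1) → … → (h,0)` (heights preserved; the tilt inflates by `1+ε_i` per notch, the constant by `A`).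
* §2 `tail_le_exp_mul_moment` — CHERNOFF at the cap: `Gibbs_K{θ(h) ≤ |Ū^j(∂p) − 1|} ≤ e^{−t·p(g_h)²}·∫ exp(t·β_h·min(…, θ(h)²))`
  (`β_h θ(h)² = p(g_h)²`, `T3FinestHeightTail.beta_mul_θBal_sq`).
* §3 ★★ the item BY NAME: `b₀ = max b₁ 1`, `p₀ = max p₁ 3`, `γ₁ = γ₁(crux)`, `t* = min t₀ t₁ / E` (so every tilt along the chain is admissible,
  `Π_{i<j}(1+ε_i) ≤ E`); §1–§2 give the per-plaquette tail `max C 0 · A^j · β_h^N · e^{−t* p(g_h)²}` at EVERY level — a tail with a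
  LEVEL-GEOMETRIC loss `A^j`, which the route-independent bookkeeping `historyTailAt_of_perPlaquette_rated` (sibling file `…Rated`, this seat)
  turns into `HistoryTailAt F γ b₀ p₀ m` for every `m ≥ 1` (on the constrained heights `h ≥ ⌊K/m⌋`, `A^j ≤ A^m β_h^{N''}`).
(The crux's «`∀ p ∃ q`» is used as given — no special `q` is needed.)

HONEST FRAMING.  The crux `NotchMomentRatioL` (stmt-QuantumFields-26202, XL) is a HYPOTHESIS of this item and stays OPEN; so do the two residual
K1 cruxes of `UnitScaleTilt`; rung R3 (`YM3TorusSU2`) is a RECORD rung — no summit, no Clay statement, no mass gap is proved or approached here.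
No `def`, no named fact, no `sorry`.

References: T. Bałaban, CMP **102** (1985) 255–275 [Balaban1985UV3] ((7) p.257, (71) p.273); J. Fröhlich, R. Israel, E. Lieb, B. Simon, CMP **62**
(1978) 1–34 [FrohlichIsraelLiebSimon1978] (Thm 4.1); C. King, CMP **102** (1986) 649–677 [King1986] ((3.12) p.657).
-/

set_option autoImplicit false

noncomputable section

open MeasureTheory
open scoped BigOperators

namespace Summit.QuantumFields.YangMills.Theorems.CutoffNotchTransport

open Literature.MathematicalPhysics.QuantumFieldTheory
open Literature.MathematicalPhysics.QuantumFieldTheory.Balaban1983to89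
open Literature.MathematicalPhysics.QuantumFieldTheory.Balaban1983to89.T3ContinuumYM3Torus
open Literature.MathematicalPhysics.QuantumFieldTheory.Balaban1983to89.T3UnitScaleTilt
open Literature.MathematicalPhysics.QuantumFieldTheory.Balaban1983to89.T3UnitLawDensityEML (ℰp measurableE_ℰp)
open Literature.MathematicalPhysics.QuantumFieldTheory.Balaban1983to89.T4Continuum (measurable_iter)
open Literature.MathematicalPhysics.QuantumFieldTheory.Balaban1983to89.T3FinestHeightTail (beta_mul_θBal_sq)

/-! ## §0 Arithmetic of the tilt inflation -/

/-- `1 ≤ Π_{i<n}(1+ε_i)` for `ε ≥ 0`. [folklore] -/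
theorem one_le_prod_one_add {ε : ℕ → ℝ} (hε : ∀ i, 0 ≤ ε i) : ∀ n : ℕ, 1 ≤ ∏ i ∈ Finset.range n, (1 + ε i)
  | 0 => by simp
  | n + 1 => by
    rw [Finset.prod_range_succ]
    exact one_le_mul_of_one_le_of_one_le (one_le_prod_one_add hε n) (by linarith [hε n])

/-! ## §1 The induction over ultraviolet notches -/

section Iterate

variable (F : T3Family) {γ b₀ p₀ : ℝ}

/-- ★ **THE NOTCH INDUCTION**: from the one-notch ratio (hypothesis `hN`, the crux's body at this family and coupling) and the bare capped moment
(hypothesis `hB`, the base), for every level `j`, run `K ≥ j`, plaquette `p` of `T^{(j)}` and tilt `t ≥ 0` with `t·Π_{i<j}(1+ε_i) ≤ min t₀ t₁`: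
`∫ exp(t·β_{K−j}·min(|Ū^j(∂p) − 1|², θ(K−j)²)) dGibbs_K ≤ A^j·(C·β_{K−j}^N)`. [cite: Balaban1985UV3, (71) p.273] -/
theorem notch_iterate {t₀ t₁ A C : ℝ} {N : ℕ} {ε : ℕ → ℝ} (hε : ∀ i, 0 ≤ ε i) (hA : 1 ≤ A)
    (hN : ∀ (K j : ℕ), j ≤ K → ∀ (t : ℝ), 0 ≤ t → t ≤ t₀ → ∀ p : Plaq (F.P (K + 1)) (j + 1), ∃ q : Plaq (F.P K) j,
      ∫ U, Real.exp (t * (γ * ((F.L : ℝ)⁻¹) ^ (K - j))⁻¹ *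
          min (GaugeGroup.dist1 (GaugeField.plaqHol
            (Averaging.iter (fun i => BlockAveraging.blockAvg (P := F.P (K + 1)) (j := i) ℰp) (j + 1) U) p) ^ 2)
            (θBal F.L γ b₀ p₀ (K - j) ^ 2)) ∂(gibbsK F ℰp γ (K + 1)) ≤
        A * ∫ U, Real.exp ((1 + ε j) * t * (γ * ((F.L : ℝ)⁻¹) ^ (K - j))⁻¹ *
          min (GaugeGroup.dist1 (GaugeField.plaqHol
            (Averaging.iter (fun i => BlockAveraging.blockAvg (P := F.P K) (j := i) ℰp) j U) q) ^ 2)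
            (θBal F.L γ b₀ p₀ (K - j) ^ 2)) ∂(gibbsK F ℰp γ K))
    (hB : ∀ (K : ℕ) (t : ℝ), 0 ≤ t → t ≤ t₁ → ∀ q : Plaq (F.P K) 0,
      ∫ U, Real.exp (t * (γ * ((F.L : ℝ)⁻¹) ^ K)⁻¹ *
          min (GaugeGroup.dist1 (GaugeField.plaqHol U q) ^ 2) (θBal F.L γ b₀ p₀ K ^ 2)) ∂(gibbsK F ℰp γ K) ≤
        C * ((γ * ((F.L : ℝ)⁻¹) ^ K)⁻¹) ^ N) :
    ∀ (j K : ℕ), j ≤ K → ∀ (p : Plaq (F.P K) j) (t : ℝ), 0 ≤ t → t * ∏ i ∈ Finset.range j, (1 + ε i) ≤ min t₀ t₁ →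
      ∫ U, Real.exp (t * (γ * ((F.L : ℝ)⁻¹) ^ (K - j))⁻¹ *
          min (GaugeGroup.dist1 (GaugeField.plaqHol
            (Averaging.iter (fun i => BlockAveraging.blockAvg (P := F.P K) (j := i) ℰp) j U) p) ^ 2)
            (θBal F.L γ b₀ p₀ (K - j) ^ 2)) ∂(gibbsK F ℰp γ K) ≤
        A ^ j * (C * ((γ * ((F.L : ℝ)⁻¹) ^ (K - j))⁻¹) ^ N) := by
  intro j
  induction j with
  | zero =>
    intro K _ p t ht htt
    rw [Finset.prod_range_zero, mul_one] at htt
    rw [Nat.sub_zero, pow_zero, one_mul]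
    exact hB K t ht (htt.trans (min_le_right _ _)) p
  | succ j ih =>
    intro K hjK p t ht htt
    obtain ⟨K', rfl⟩ : ∃ K', K = K' + 1 := ⟨K - 1, by omega⟩
    have hj' : j ≤ K' := by omega
    rw [Nat.add_sub_add_right]
    -- the tilt bookkeeping
    have hP1 : 1 ≤ ∏ i ∈ Finset.range (j + 1), (1 + ε i) := one_le_prod_one_add hε (j + 1)
    have ht₀ : t ≤ t₀ := by
      have : t ≤ t * ∏ i ∈ Finset.range (j + 1), (1 + ε i) := le_mul_of_one_le_right ht hP1
      exact this.trans (htt.trans (min_le_left _ _))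
    have htt' : (1 + ε j) * t * ∏ i ∈ Finset.range j, (1 + ε i) ≤ min t₀ t₁ := by
      rw [Finset.prod_range_succ] at htt
      calc (1 + ε j) * t * ∏ i ∈ Finset.range j, (1 + ε i) = t * ((∏ i ∈ Finset.range j, (1 + ε i)) * (1 + ε j)) := by ring
        _ ≤ min t₀ t₁ := htt
    have ht' : 0 ≤ (1 + ε j) * t := mul_nonneg (by linarith [hε j]) ht
    -- one notch, then the induction hypothesis one run below
    obtain ⟨q, hq⟩ := hN K' j hj' t ht ht₀ p
    have hih := ih K' hj' q ((1 + ε j) * t) ht' htt'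
    have hA0 : 0 ≤ A := zero_le_one.trans hA
    calc _ ≤ A * ∫ U, Real.exp ((1 + ε j) * t * (γ * ((F.L : ℝ)⁻¹) ^ (K' - j))⁻¹ *
          min (GaugeGroup.dist1 (GaugeField.plaqHol
            (Averaging.iter (fun i => BlockAveraging.blockAvg (P := F.P K') (j := i) ℰp) j U) q) ^ 2)
            (θBal F.L γ b₀ p₀ (K' - j) ^ 2)) ∂(gibbsK F ℰp γ K') := hq
      _ ≤ A * (A ^ j * (C * ((γ * ((F.L : ℝ)⁻¹) ^ (K' - j))⁻¹) ^ N)) := mul_le_mul_of_nonneg_left hih hA0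
      _ = A ^ (j + 1) * (C * ((γ * ((F.L : ℝ)⁻¹) ^ (K' - j))⁻¹) ^ N) := by rw [pow_succ]; ring

end Iterate

/-! ## §2 Chernoff at the cap -/

section Chernoff

variable (F : T3Family) {γ : ℝ}

/-- **CHERNOFF AT THE CAP**: for `t ≥ 0`, `Gibbs_K{θ(K−j) ≤ |Ū^j(∂p) − 1|} ≤ e^{−t·p(g_{K−j})²}·∫ exp(t·β_{K−j}·min(|Ū^j(∂p) − 1|², θ(K−j)²)) dGibbs_K`:
on the event the capped variable equals `θ(K−j)²`, and `β_{K−j}θ(K−j)² = p(g_{K−j})²` (Markov's inequality for the bounded, measurable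
integrand). [cite: Balaban1985UV3, (7) p.257 and (71) p.273] -/
theorem tail_le_exp_mul_moment (hγ : 0 < γ) (hγ1 : γ ≤ 1) {b₀ : ℝ} (hb₀ : 0 < b₀) (p₀ : ℝ) (K j : ℕ) (p : Plaq (F.P K) j)
    {t : ℝ} (ht : 0 ≤ t) :
    (gibbsK F ℰp γ K).real
        {U | θBal F.L γ b₀ p₀ (K - j) ≤
          GaugeGroup.dist1 (GaugeField.plaqHol
            (Averaging.iter (fun i => BlockAveraging.blockAvg (P := F.P K) (j := i) ℰp) j U) p)} ≤
      Real.exp (-(t * B10.pFun b₀ p₀ (Real.sqrt (γ * ((F.L : ℝ)⁻¹) ^ (K - j))) ^ 2)) *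
        ∫ U, Real.exp (t * (γ * ((F.L : ℝ)⁻¹) ^ (K - j))⁻¹ *
          min (GaugeGroup.dist1 (GaugeField.plaqHol
            (Averaging.iter (fun i => BlockAveraging.blockAvg (P := F.P K) (j := i) ℰp) j U) p) ^ 2)
            (θBal F.L γ b₀ p₀ (K - j) ^ 2)) ∂(gibbsK F ℰp γ K) := by
  haveI := isProbabilityMeasure_gibbsK F ℰp hγ.le K
  have hL1 : 1 ≤ F.L := le_of_lt F.hL.2
  have hL0 : (0 : ℝ) < F.L := by exact_mod_cast lt_trans zero_lt_one F.hL.2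
  have hβθ : (γ * ((F.L : ℝ)⁻¹) ^ (K - j))⁻¹ * θBal F.L γ b₀ p₀ (K - j) ^ 2 =
      B10.pFun b₀ p₀ (Real.sqrt (γ * ((F.L : ℝ)⁻¹) ^ (K - j))) ^ 2 := beta_mul_θBal_sq F hγ b₀ p₀ (K - j)
  set β : ℝ := (γ * ((F.L : ℝ)⁻¹) ^ (K - j))⁻¹ with hβdef
  have hβ : 0 < β := by rw [hβdef]; exact inv_pos.mpr (mul_pos hγ (pow_pos (inv_pos.mpr hL0) _))
  set θ : ℝ := θBal F.L γ b₀ p₀ (K - j) with hθdef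
  have hθ0 : 0 ≤ θ := (T3MinimiserStabilityReduction.θBal_pos hL1 hγ hγ1 hb₀ p₀ (K - j)).le
  set d : GaugeField (F.P K) 0 (Matrix.specialUnitaryGroup (Fin 2) ℂ) → ℝ := fun U =>
    GaugeGroup.dist1 (GaugeField.plaqHol
      (Averaging.iter (fun i => BlockAveraging.blockAvg (P := F.P K) (j := i) ℰp) j U) p) with hddef
  set f : GaugeField (F.P K) 0 (Matrix.specialUnitaryGroup (Fin 2) ℂ) → ℝ := fun U =>
    Real.exp (t * β * min (d U ^ 2) (θ ^ 2)) with hfdef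
  -- measurability and integrability of the capped integrand
  have hd : Measurable d :=
    RegularGaugeGroup.measurable_dist1.comp ((Missing.measurable_plaqHol p).comp
      (measurable_iter _ (F.avgMeasurable_of_measurableE ℰp measurableE_ℰp K) j))
  have hfm : Measurable f := Real.measurable_exp.comp (((hd.pow_const 2).min measurable_const).const_mul (t * β))
  have hfle : ∀ U, f U ≤ Real.exp (t * β * θ ^ 2) := fun U =>
    Real.exp_le_exp.mpr (mul_le_mul_of_nonneg_left (min_le_right _ _) (mul_nonneg ht hβ.le))
  have hfint : Integrable f (gibbsK F ℰp γ K) := by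
    refine (integrable_const (Real.exp (t * β * θ ^ 2))).mono' hfm.aestronglyMeasurable (ae_of_all _ fun U => ?_)
    rw [Real.norm_eq_abs, abs_of_pos (Real.exp_pos _)]
    exact hfle U
  -- Markov at the level `exp(tβθ²)`; on the event the capped variable IS `θ²`
  have hmarkov := mul_meas_ge_le_integral_of_nonneg (ae_of_all _ fun U => (Real.exp_pos _).le) hfint (Real.exp (t * β * θ ^ 2))
  have hsub : {U | θ ≤ d U} ⊆ {U | Real.exp (t * β * θ ^ 2) ≤ f U} := by
    intro U hU
    have hU' : θ ≤ d U := hU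
    have hmin : min (d U ^ 2) (θ ^ 2) = θ ^ 2 := min_eq_right (pow_le_pow_left₀ hθ0 hU' 2)
    show Real.exp (t * β * θ ^ 2) ≤ Real.exp (t * β * min (d U ^ 2) (θ ^ 2))
    rw [hmin]
  have hexp0 : 0 < Real.exp (t * β * θ ^ 2) := Real.exp_pos _
  change (gibbsK F ℰp γ K).real {U | θ ≤ d U} ≤
    Real.exp (-(t * B10.pFun b₀ p₀ (Real.sqrt (γ * ((F.L : ℝ)⁻¹) ^ (K - j))) ^ 2)) * ∫ U, f U ∂(gibbsK F ℰp γ K)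
  rw [← hβθ, ← mul_assoc, Real.exp_neg]
  calc (gibbsK F ℰp γ K).real {U | θ ≤ d U} ≤ (gibbsK F ℰp γ K).real {U | Real.exp (t * β * θ ^ 2) ≤ f U} :=
        measureReal_mono hsub (measure_ne_top _ _)
    _ ≤ (Real.exp (t * β * θ ^ 2))⁻¹ * ∫ U, f U ∂(gibbsK F ℰp γ K) := by
        rw [le_inv_mul_iff₀ hexp0]; exact hmarkov

end Chernoff

/-! ## §3 The item BY NAME -/

/-- ★★ **`HistoryTailOfNotch` (stmt-QuantumFields-26204), PROVED**: `NotchMomentRatioL → BareCappedMomentL →` for every `L`, `b₁`, `p₁` the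
thresholds `b₀ = max b₁ 1`, `p₀ = max p₁ 3` serve, and for every `m ≥ 1`, with `γ₁ = γ₁(crux)`, every family with `F.L = L` and every
`0 < γ ≤ γ₁` has `HistoryTailAt F γ b₀ p₀ m` — the notch induction (§1) at the tilt `t* = min t₀ t₁ / E`, Chernoff (§2), and the rated
bookkeeping `historyTailAt_of_perPlaquette_rated`. [cite: Balaban1985UV3, (71) p.273; King1986, (3.12) p.657] -/
theorem cutoffNotchTransport_historyTailOfNotch_proof :
    Summit.QuantumFields.YangMills.Theses.CutoffNotchTransport.HistoryTailOfNotch := by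
  intro hN hB L b₁ p₁
  have hb₀ : (0 : ℝ) < max b₁ 1 := lt_of_lt_of_le one_pos (le_max_right _ _)
  have hp₀ : (2 : ℝ) < max p₁ 3 := lt_of_lt_of_le (by norm_num) (le_max_right _ _)
  have hp₀1 : (1 : ℝ) ≤ max p₁ 3 := le_trans (by norm_num) (le_max_right _ _)
  refine ⟨max b₁ 1, max p₁ 3, le_max_left _ _, le_max_left _ _, hb₀, hp₀, ?_⟩
  intro m hm
  obtain ⟨γN, t₀, A, E, ε, hγN, hγN1, ht₀, hA1, hε, hE, hNotch⟩ := hN L (max b₁ 1) (max p₁ 3) hb₀ hp₀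
  obtain ⟨t₁, CB, NB, ht₁, hBase⟩ := hB
  refine ⟨γN, hγN, ?_⟩
  intro F γ hFL hγ hγ₁
  have hγ1 : γ ≤ 1 := hγ₁.trans hγN1
  -- the admissible top tilt `t* = min t₀ t₁ / E`
  have hE1 : 1 ≤ E := by simpa using hE 0
  have hE0 : 0 < E := one_pos.trans_le hE1
  set ts : ℝ := min t₀ t₁ / E with hts
  have hts0 : 0 < ts := div_pos (lt_min ht₀ ht₁) hE0
  have htsE : ∀ j : ℕ, ts * ∏ i ∈ Finset.range j, (1 + ε i) ≤ min t₀ t₁ := by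
    intro j
    calc ts * ∏ i ∈ Finset.range j, (1 + ε i) ≤ ts * E := mul_le_mul_of_nonneg_left (hE j) hts0.le
      _ = min t₀ t₁ := by rw [hts]; field_simp
  -- the rated per-plaquette tail at every level, then the bookkeeping
  refine historyTailAt_of_perPlaquette_rated F hγ hγ1 hb₀ hp₀1 hm (C := max CB 0) (R := A) (A := NB) (c := ts)
    (le_max_right _ _) hA1 hts0 ?_
  intro K j hjK p
  have hiter := notch_iterate F hε hA1 (hNotch F γ hFL hγ hγ₁)
    (fun K t ht ht1 q => hBase F γ (max b₁ 1) (max p₁ 3) hγ hγ1 hb₀ K t ht ht1 q) j K hjK p ts hts0.le (htsE j)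
  have hcher := tail_le_exp_mul_moment F hγ hγ1 hb₀ (max p₁ 3) K j p hts0.le
  have hA0 : 0 ≤ A ^ j := pow_nonneg (zero_le_one.trans hA1) j
  have hβ0 : 0 ≤ (γ * ((F.L : ℝ)⁻¹) ^ (K - j))⁻¹ ^ NB := by positivity
  have hexp0 : 0 ≤ Real.exp (-(ts * B10.pFun (max b₁ 1) (max p₁ 3) (Real.sqrt (γ * ((F.L : ℝ)⁻¹) ^ (K - j))) ^ 2)) :=
    (Real.exp_pos _).le
  refine hcher.trans ?_
  refine (mul_le_mul_of_nonneg_left hiter hexp0).trans ?_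
  have hCB : CB * (γ * ((F.L : ℝ)⁻¹) ^ (K - j))⁻¹ ^ NB ≤ max CB 0 * (γ * ((F.L : ℝ)⁻¹) ^ (K - j))⁻¹ ^ NB :=
    mul_le_mul_of_nonneg_right (le_max_left _ _) hβ0
  calc Real.exp (-(ts * B10.pFun (max b₁ 1) (max p₁ 3) (Real.sqrt (γ * ((F.L : ℝ)⁻¹) ^ (K - j))) ^ 2)) *
        (A ^ j * (CB * (γ * ((F.L : ℝ)⁻¹) ^ (K - j))⁻¹ ^ NB))
      ≤ Real.exp (-(ts * B10.pFun (max b₁ 1) (max p₁ 3) (Real.sqrt (γ * ((F.L : ℝ)⁻¹) ^ (K - j))) ^ 2)) *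
        (A ^ j * (max CB 0 * (γ * ((F.L : ℝ)⁻¹) ^ (K - j))⁻¹ ^ NB)) :=
        mul_le_mul_of_nonneg_left (mul_le_mul_of_nonneg_left hCB hA0) hexp0
    _ = max CB 0 * A ^ j * (γ * ((F.L : ℝ)⁻¹) ^ (K - j))⁻¹ ^ NB *
        Real.exp (-(ts * B10.pFun (max b₁ 1) (max p₁ 3) (Real.sqrt (γ * ((F.L : ℝ)⁻¹) ^ (K - j))) ^ 2)) := by ring

end Summit.QuantumFields.YangMills.Theorems.CutoffNotchTransport

end
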